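import Summits.ValiantsHypothesis.ValiantsHypothesis.Theorems.BarrierLeverNaturalProofsAgainstAllLinearSizesOfCount
import Summits.ValiantsHypothesis.ValiantsHypothesis.Theorems.BarrierLeverGradientGenericFibreCount

/-!
# Route BarrierLever — item `NaturalProofsAgainstAllLinearSizes` (stmt-ValiantsHypothesis-20156):
# Baur–Strassen is a poly(N)-natural proof against EVERY linear size `c·n`

The two halves are tree theorems:

* the complexity half `NaturalProofsAgainstAllLinearSizesOfCount` (item stmt-ValiantsHypothesis-19261,
  `…Theorems.BarrierLever.NaturalProofsAgainstAllLinearSizes.naturalProofsAgainstAllLinearSizesOfCount`,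
  files `…OfCountCertificate` / `…OfCountSize` / `…OfCount`): with `k n = 3cn/(log₂(n-1)-1) + 1`
  restricted variables, the Macaulay determinant of the gradient of the restricted top form is a
  non-zero distinguisher of level `a = 84c+39` vanishing on every `f` of degree `≤ n` and size
  `≤ c·n` for `n ≥ n₀ = 2^(6c+3)+1` — conditionally on the generic gradient fibre count;
* the algebro-geometric half `GradientGenericFibreCount` (item stmt-ValiantsHypothesis-19256,
  `…Theorems.BarrierLever.HBasis.gradientGenericFibreCount`, six files `…GradientGenericFibreCount*`):
  for `g` of degree `≤ d`, `d ≥ 3`, with smooth top form, some fibre of `∇g` is finite with at least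
  `(d-1)^k` points (H-bases, Hilbert count, Macaulay regular sequence, Jacobian/Kähler
  reducedness).

**`naturalProofsAgainstAllLinearSizes`** = the signature of item stmt-ValiantsHypothesis-20156
VERBATIM: modus ponens of the two.

Reading (cell chart of FSV Question 6 / crux stmt-14610, size axis): an algebraically natural proof
of polynomial size `N^a` exists against ALL linear sizes `c·n` (one level `a = a(c)` per slope `c`).
The method ceiling is `Θ(a·n)`; this says NOTHING about sizes `n^b`, `b ≥ 2`, i.e. nothing about
Question 6 itself, which asks for one level `a` against every polynomial size `n^b`.

Lean text of both halves authored by the cell planner seat `valiant-natproofs-p2` (gen 4,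
HOME/HBasis-p2g4.lean + NaturalBSAll-p2g4.lean = AllItems-p2g4.lean, kernel-checked rc 0 / 0 sorries;
referee REF-G11 / REF-G12 / REF-G13 PASS), ported by the prover seats `valiant-natproofs-prover`
(gen 4) and `val-np-p1`.

WHAT THIS IS NOT: not a statement about polynomial sizes `n^b`, `b ≥ 2`; not a decision of FSV
Question 6 / crux stmt-14610; nothing about `VP` vs `VNP`. (3,4)-type method validation at a known
separation, not summit motion.

References: Baur–Strassen 1983; Strassen 1973 (degree bound); [CoxLittleOSheaUsing2005] Ch. 3 Thm.
(5.5); Macaulay 1916; [ForbesShpilkaVolk2018] Question 6 (context).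
-/

-- layout Summits/ValiantsHypothesis/ValiantsHypothesis forces the duplicated namespace component
set_option linter.dupNamespace false

namespace Summit.ValiantsHypothesis.ValiantsHypothesis.Theorems.BarrierLever.NaturalProofsAgainstAllLinearSizes

/-- **Item `NaturalProofsAgainstAllLinearSizes` (stmt-ValiantsHypothesis-20156), signature
VERBATIM**: for every `c` there are `a, n₀` such that for all `n ≥ n₀` the coefficient vectors of
the degree-`≤ n`, size-`≤ c·n` polynomials in `n` variables are NOT a hitting set for
`Distinguishers ℂ n a` — Baur–Strassen, made poly(N)-constructive, is an algebraically natural proof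
against every linear size. Proof: the conditional form (item 19261) applied to the generic gradient
fibre count (item 19256). -/
theorem naturalProofsAgainstAllLinearSizes :
    ∀ c : ℕ, ∃ a n₀ : ℕ, ∀ n ≥ n₀, ¬ Literature.Barriers.ValiantsHypothesis.IsSuccinctHittingSet (Literature.Barriers.ValiantsHypothesis.degLEMonomials n) {f : MvPolynomial (Fin n) ℂ | f.totalDegree ≤ n ∧ Literature.Computability.AlgebraicComplexity.complexity f ≤ c * n} (Literature.Barriers.ValiantsHypothesis.Distinguishers ℂ n a) :=
  naturalProofsAgainstAllLinearSizesOfCount HBasis.gradientGenericFibreCount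

end Summit.ValiantsHypothesis.ValiantsHypothesis.Theorems.BarrierLever.NaturalProofsAgainstAllLinearSizes
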